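import Literature.MathematicalPhysics.QuantumFieldTheory.Balaban1983to89.B9Eq315QLipschitz
import Literature.MathematicalPhysics.QuantumFieldTheory.Balaban1983to89.B7LocalityGeneral

/-!
# `Balaban1983to89.B9Eq383QSemiLocal` — T. Bałaban, *Propagators for lattice gauge theories in a background field*, Commun. Math. Phys. **99**
# (1985) 389–434 [Balaban1985BackgroundPropagators] (3.83) p. 407, with *Averaging operations for lattice gauge theories*, Commun. Math. Phys. **98**
# (1985) 17–51 [Balaban1985Averaging] p. 24: THE ONE-STEP AVERAGING `Q(U)` OF (3.15) ON THE TORUS IS SEMI-LOCAL — `(Q(U)A)(c)` DEPENDS ONLY ON `A`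
# RESTRICTED TO THE BONDS OF `B(c₋) ∪ B(c₊)` — HENCE THE pub-balaban NE9 CHAIN'S `δ_Q`-LETTER (`B9Eq315QLipschitz.norm_QtorusW_sub_flat_le`,
# `‖Q(U)f − Q(1)f‖ ≤ δ_Q‖f‖`) HOLDS WITH A VOLUME-FREE CONSTANT: `δ_Q = M_φ′M_φ·√(2d·c₁∕c₀)·102(d+1)²L·ε_U` (the factor `√(c₁·#bonds∕c₀)` of the
# crude sup ↔ `L²` comparison replaced by `√(2d·c₁∕c₀)`, `2d` = the multiplicity of the blocks `B(c₋) ∪ B(c₊)` over the coarse bonds `c`)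

statement-level skeleton of published theorems with citation tags; proofs where landed; nothing here is a claim about the Yang–Mills mass gap

PDF held: `paper:balaban1985-cmp99-background-propagators` (+388) pp. 393, 406–407; `paper:balaban1985-cmp98-averaging` p. 24, p. 36 — read by this
seat (2026-08-22) in the held text layers.

THE PRINT (verbatim).  [B9] p. 407, after (3.82): *«The operator P₂(A) is a sum of three terms obtained by the expansion of averaging operators. It
is a semi-local operator in the sense that the value (P₂(A)A′)(b) at a bond b ∈ B_j(Λ_j) depends on A, A′ restricted to j-blocks neighbouring the
block containing the bond b. It satisfies the bound |(P₂(A)A′)(b)| ≤ O(1)α₁(L^jη)^{−2}|A′|, b ∈ B_j(Λ_j), (3.83) with the norm |A′| restricted to the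
blocks defined above.»*  [B7] p. 24: *«this definition is local in the sense that Ū_c … depends only on the bond variables U_b for b ⊂ B(c₋) ∪
B(c₊)»*; p. 34: *«an analytic function of the variables A_b, b ⊂ B(c₋) ∪ B(c₊)»*.

WHY THIS FILE (cell context).  The NE9 owner's (gen 80) junction `B9Thm311SmallFieldCoercivity`/`B9Thm311SmallFieldClosed` consumes this lineage's
`δ_Q`-letter `B9Eq315QLipschitz.norm_QtorusW_sub_flat_le` (gen 68, p311750), whose constant carries `√(c₁·Fintype.card (Bond d m)∕c₀)` — one of the
declared non-uniform constants of the small-field thresholds ((M3) there; ne9-leaf-03 g58's census W-ne9leaf03-g58-1).  The volume factor is an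
artefact of bounding every coarse value by the GLOBAL sup of `A`; print's (3.83) uses the sup over the neighbouring blocks only.  This file proves
the semi-locality of the torus `Q(U)` from the cell's kernel locality `B7LocalityGeneral.Qcov_congr` (b07) and re-sums with multiplicity `2d`.

WHAT IS PROVED (sorry-free; no `Prop` placeholder; no inequality of the papers asserted as a hypothesis-free fact about their objects).
* §1 `perSite_div_of_mem_block` (a site of `ℤ^d` whose `i`-th coordinate lies in `[L·k, L·k + L − 1]` reads, on the torus `Π ℤ∕(L·m_i)`, in the
  block of coarse coordinate `k mod m_i`), **`blockCoord_perSite_of_inBox`** (the `ℤ^d` box `[L·y, L·y + (L−1) + L·δ_{·κ}]` of `B7Prop1Local.bondHi`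
  projects into `B(y) ∪ B(y + e_κ)` of the torus, wrap-around included), **`QtorusLin_congr_local`** — `(Q(U)A)(c) = (Q(U)A′)(c)` whenever `A`, `A′`
  agree on the fine bonds starting in `B(c₋) ∪ B(c₊)` (`blockCoord b₋ ∈ {c.1, shift c.2 c.1}`): `Qcov_congr` under the `deriv` of (122).
* §2 **`norm_QtorusLin_sub_flat_le_local`** — `‖(Q(U)A)(c) − (Q(1)A)(c)‖ ≤ 102(d+1)²·L·ε_U·a` for ANY bound `a ≥ 0` of `‖A b‖` on those bonds only
  (this lineage's `norm_QtorusLin_sub_flat_le` at the truncation of `A`).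
* §3 `card_near_le` (a fine bond starts in the blocks of at most `2d` coarse bonds), `sum_sum_near_le` (`Σ_c Σ_{b near c} F b ≤ 2d·Σ_b F b` for
  `F ≥ 0`), `norm_le_sqrt_sum_near`, and **`norm_QtorusW_sub_flat_le_local`** — ON THE CHAIN'S CARRIERS: `‖Q(U)f − Q(1)f‖ ≤
  M_φ′·M_φ·√(2d·c₁∕c₀)·(102(d+1)²·L·ε_U)·‖f‖` — the statement of `B9Eq315QLipschitz.norm_QtorusW_sub_flat_le` with `Fintype.card (Bond d m)`
  REPLACED BY `2d`, same hypotheses, so the owner's `hQ` slots take it by the same `exact`.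
MODEL / DECLARED READINGS.  (M1) as `B9Eq315QTorus`/`B9Eq315QLipschitz`: torus `TSite d (L·m)`, periodic extension `perCfg`, block corner
`cornerSite`, fibre `W ≃ 𝔸` along `φ` with bounds `M_φ`, `M_φ′`, fine weight `c₀`, FREE coarse weight `c₁` (print: `c₁∕c₀ = L^d`, so the constant
reads `M_φ′M_φ√(2d·L^d)·102(d+1)²Lε_U` — `d`, `L`-dependent, volume-free, as print's «O(1) depends only on d and L» p. 406).  (M2) hypotheses =
the displayed regularity letters `QtorusW` carries + `0 ≤ ε_U`, `‖U(b) − 1‖ ≤ ε_U`.  (M3) NOT HERE: print's (3.83) for the multi-level `P₂(A)`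
(three terms, `(L^jη)^{−2}` weights); the flat operator norm `‖Q(1)‖` (ne9-leaf-03's `B9Eq315QFlatNorm`); [B7] Prop. 3 ∕ (123).
HONEST SCOPE.  A [folklore] locality-and-counting argument over this lineage's own letter with explicit constants; NOT summit progress (cell
pub-balaban: NE9 NOT PRINTED / NOT PROVED; spine PROVED 0/9; rung (B)+1 finite T⁴ — NOT infinite volume, NOT mass gap, NOT Clay).  Filed by the NE9
formalisation leaf `b2b-balaban-t4-ne9-formalise-leaf-04` (gen 69); NEW file importing `B9Eq315QLipschitz`, `B7LocalityGeneral`; nothing modified.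
Net new unproved facts: 0.
-/

noncomputable section

open scoped BigOperators

namespace Literature.MathematicalPhysics.QuantumFieldTheory.Balaban1983to89.B9Eq383QSemiLocal

open B4Sect5Torus (TSite)
open B9SectCLatticeCarrier (Bond shift unshift)
open B7Prop1Explicit (U1 Wcx boxVec e)
open B7Prop1Local (InBox AgreeOn bondHi)
open B7Prop3GeneralLinear (linQcov Qcov)
open B7LocalityGeneral (Qcov_congr)
open B9Eq319QprimeTorus (fineP blockCoord)
open B9Eq311L2Pairing (WL2)
open B11Eq103H1Complex (BondL2K)
open B9Eq315QTorus (perCfg perSite cornerSite QtorusLin QtorusLin_apply QtorusW QtorusW_apply)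
open B9Eq315QLipschitz (norm_QtorusLin_sub_flat_le)

variable {d : ℕ} (L : ℕ) (m : Fin d → ℕ) [∀ i, NeZero (fineP L m i)]

/-! ## §1 Semi-locality of `Q(U)` on the torus: the `ℤ^d` box of a coarse bond projects into `B(c₋) ∪ B(c₊)` -/

section Locality

/-- A site of `ℤ^d` whose `i`-th coordinate lies in `[L·k, L·k + L − 1]` is read on the torus `Π_i ℤ∕(L·m_i)ℤ` (`perSite`) in the block of coarse
`i`-th coordinate `k mod m_i`. [cite: Balaban1985Averaging, (1)–(2) p.17] -/
theorem perSite_div_of_mem_block (i : Fin d) (k : ℕ) (x : B7Prop1Explicit.Site d) (h1 : (L : ℤ) * k ≤ x i) (h2 : x i ≤ (L : ℤ) * k + ((L : ℤ) - 1)) :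
    ((perSite (fineP L m) x i : ℕ)) / L = k % m i := by
  have hLm : L * m i ≠ 0 := NeZero.ne (fineP L m i)
  have hL0 : 0 < L := Nat.pos_of_ne_zero fun h => hLm (by rw [h, zero_mul])
  have hm0 : 0 < m i := Nat.pos_of_ne_zero fun h => hLm (by rw [h, mul_zero])
  -- `x i` is a natural number `n = L·k + r`, `r < L`
  have hx0 : 0 ≤ x i := le_trans (by positivity) h1
  obtain ⟨n, hn⟩ : ∃ n : ℕ, x i = n := ⟨(x i).toNat, (Int.toNat_of_nonneg hx0).symm⟩
  have hn1 : L * k ≤ n := by exact_mod_cast (hn ▸ h1 : ((L : ℤ) * k ≤ (n : ℤ)))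
  have hn2 : n ≤ L * k + (L - 1) := by
    have h2' : (n : ℤ) ≤ (L : ℤ) * k + ((L : ℤ) - 1) := hn ▸ h2
    have hL1 : ((L - 1 : ℕ) : ℤ) = (L : ℤ) - 1 := by rw [Nat.cast_sub hL0, Nat.cast_one]
    rw [← hL1] at h2'
    exact_mod_cast h2'
  obtain ⟨r, hr, rfl⟩ : ∃ r, r < L ∧ n = L * k + r := ⟨n - L * k, by omega, by omega⟩
  -- the torus coordinate is `n mod (L·m_i)`
  have hval : ((perSite (fineP L m) x i : ℕ)) = (L * k + r) % (L * m i) := by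
    show ((x i) % ((fineP L m i : ℕ) : ℤ)).toNat = _
    rw [hn, show ((fineP L m i : ℕ) : ℤ) = ((L * m i : ℕ) : ℤ) from rfl, ← Int.natCast_mod, Int.toNat_natCast]
  -- `L·k + r = (L·m_i)·(k ∕ m_i) + (L·(k mod m_i) + r)` with the last bracket `< L·m_i`
  have hsplit : L * k + r = L * (k % m i) + r + L * m i * (k / m i) := by
    have := Nat.div_add_mod k (m i)
    calc L * k + r = L * (m i * (k / m i) + k % m i) + r := by rw [Nat.div_add_mod]
      _ = L * (k % m i) + r + L * m i * (k / m i) := by ring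
  have hlt : L * (k % m i) + r < L * m i := by
    have hkm : k % m i + 1 ≤ m i := Nat.mod_lt _ hm0
    calc L * (k % m i) + r < L * (k % m i) + L := by omega
      _ = L * (k % m i + 1) := by ring
      _ ≤ L * m i := Nat.mul_le_mul_left L hkm
  rw [hval, hsplit, Nat.add_mul_mod_self_left, Nat.mod_eq_of_lt hlt, Nat.mul_add_div hL0, Nat.div_eq_of_lt hr, add_zero]

/-- **THE `ℤ^d` BOX OF A COARSE BOND PROJECTS INTO `B(c₋) ∪ B(c₊)`**: a site `x` with `L·y_i ≤ x_i ≤ L·y_i + (L−1) + L·δ_{iκ}` (the box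
`[cornerSite L y, bondHi L (cornerSite L y) κ]` on which `B7LocalityGeneral.Qcov_congr` localises the one-step map) reads on the torus in the block
`B(y)` or in `B(y + e_κ)` (wrap-around at `y_κ + 1 = m_κ` included). [cite: Balaban1985Averaging, (2) p.17, p.24] -/
theorem blockCoord_perSite_of_inBox (y : TSite d m) (κ : Fin d) (x : B7Prop1Explicit.Site d) (hx : InBox (cornerSite L y) (bondHi L (cornerSite L y) κ) x) :
    blockCoord L m (perSite (fineP L m) x) = y ∨ blockCoord L m (perSite (fineP L m) x) = shift κ y := by
  have hlo : ∀ i, (L : ℤ) * ((y i : ℕ) : ℤ) ≤ x i := fun i => (hx i).1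
  have hhi : ∀ i, x i ≤ (L : ℤ) * ((y i : ℕ) : ℤ) + ((L : ℤ) - 1) + (if i = κ then (L : ℤ) else 0) := fun i => (hx i).2
  have hm : ∀ i, (y i : ℕ) % m i = (y i : ℕ) := fun i => Nat.mod_eq_of_lt (y i).isLt
  by_cases hκ : x κ ≤ (L : ℤ) * ((y κ : ℕ) : ℤ) + ((L : ℤ) - 1)
  · -- first block
    left
    funext i
    apply Fin.ext
    rw [B9Eq319QprimeTorus.blockCoord_apply_val]
    have h2 : x i ≤ (L : ℤ) * ((y i : ℕ) : ℤ) + ((L : ℤ) - 1) := by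
      by_cases hi : i = κ
      · subst hi; exact hκ
      · have := hhi i; rw [if_neg hi, add_zero] at this; exact this
    rw [perSite_div_of_mem_block L m i (y i : ℕ) x (hlo i) h2, hm]
  · -- second block in direction `κ`
    right
    funext i
    apply Fin.ext
    rw [B9Eq319QprimeTorus.blockCoord_apply_val]
    by_cases hi : i = κ
    · subst hi
      have h1 : (L : ℤ) * (((y i : ℕ) + 1 : ℕ) : ℤ) ≤ x i := by push_cast; rw [not_le] at hκ; linarith
      have h2 : x i ≤ (L : ℤ) * (((y i : ℕ) + 1 : ℕ) : ℤ) + ((L : ℤ) - 1) := by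
        have := hhi i; rw [if_pos rfl] at this; push_cast; linarith
      rw [perSite_div_of_mem_block L m i ((y i : ℕ) + 1) x h1 h2, B9SectCLatticeCarrier.shift_apply_val]
    · have h2 : x i ≤ (L : ℤ) * ((y i : ℕ) : ℤ) + ((L : ℤ) - 1) := by
        have := hhi i; rw [if_neg hi, add_zero] at this; exact this
      rw [perSite_div_of_mem_block L m i (y i : ℕ) x (hlo i) h2, hm, B9SectCLatticeCarrier.shift_apply_ne hi]

variable {𝔸 : Type*} [NormedRing 𝔸] [NormedAlgebra ℂ 𝔸] [CompleteSpace 𝔸] [NormOneClass 𝔸] (hL : 1 ≤ L)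
  (U : Bond d (fineP L m) → 𝔸ˣ) {α : ℝ} (hα1 : α ≤ 1 / 64)
  (hU1 : ∀ (x : B7Prop1Explicit.Site d) (κ : Fin d), perCfg (fineP L m) U x κ ∈ U1 𝔸)
  (hreg : ∀ (y : TSite d m) (κ : Fin d) (r : Fin d → Fin L),
    ‖((Wcx L (perCfg (fineP L m) U) (cornerSite L y) κ (boxVec L r) : 𝔸ˣ) : 𝔸) - 1‖ ≤ α)

/-- **`Q(U)` ON THE TORUS IS SEMI-LOCAL**: if `A` and `A′` agree on the fine bonds starting in `B(c₋) ∪ B(c₊)` (`blockCoord b₋ ∈ {c.1, c.1 + e_{c.2}}`)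
then `(Q(U)A)(c) = (Q(U)A′)(c)` — the kernel locality `B7LocalityGeneral.Qcov_congr` of the one-step map (121), carried through the `t`-derivative
(122) (`linQcov`) and the periodic extensions of `QtorusLin_apply`. [cite: Balaban1985Averaging, p.24, (121)–(122) p.36; Balaban1985BackgroundPropagators, (3.15) p.393, (3.83) p.407] -/
theorem QtorusLin_congr_local {A A' : Bond d (fineP L m) → 𝔸} (c : Bond d m)
    (h : ∀ b : Bond d (fineP L m), (blockCoord L m b.1 = c.1 ∨ blockCoord L m b.1 = shift c.2 c.1) → A b = A' b) :
    QtorusLin L m hL U hα1 hU1 hreg A c = QtorusLin L m hL U hα1 hU1 hreg A' c := by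
  rw [QtorusLin_apply, QtorusLin_apply]
  congr 1
  unfold linQcov
  congr 1
  funext t
  refine Qcov_congr L hL (cornerSite L c.1) c.2 (fun _ _ _ _ => rfl) fun x κ' hx _ => ?_
  simp only [Pi.smul_apply, B9Eq315QTorus.perCfg_apply]
  rw [h (perSite (fineP L m) x, κ') (blockCoord_perSite_of_inBox L m c.1 c.2 x hx)]

end Locality

/-! ## §2 The Lipschitz letter per coarse bond with the LOCAL sup of `A` -/

section LocalSup

variable {𝔸 : Type*} [NormedRing 𝔸] [NormedAlgebra ℂ 𝔸] [CompleteSpace 𝔸] [NormOneClass 𝔸] (hL : 1 ≤ L)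
  (U : Bond d (fineP L m) → 𝔸ˣ) {α : ℝ} (hα1 : α ≤ 1 / 64)
  (hU1 : ∀ (x : B7Prop1Explicit.Site d) (κ : Fin d), perCfg (fineP L m) U x κ ∈ U1 𝔸)
  (hreg : ∀ (y : TSite d m) (κ : Fin d) (r : Fin d → Fin L),
    ‖((Wcx L (perCfg (fineP L m) U) (cornerSite L y) κ (boxVec L r) : 𝔸ˣ) : 𝔸) - 1‖ ≤ α)
  {α' : ℝ} (hα1' : α' ≤ 1 / 64)
  (hU1' : ∀ (x : B7Prop1Explicit.Site d) (κ : Fin d), perCfg (fineP L m) (fun _ : Bond d (fineP L m) => (1 : 𝔸ˣ)) x κ ∈ U1 𝔸)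
  (hreg' : ∀ (y : TSite d m) (κ : Fin d) (r : Fin d → Fin L),
    ‖((Wcx L (perCfg (fineP L m) (fun _ : Bond d (fineP L m) => (1 : 𝔸ˣ))) (cornerSite L y) κ (boxVec L r) : 𝔸ˣ) : 𝔸) - 1‖ ≤ α')
  {εU : ℝ} (hεU : 0 ≤ εU) (hUε : ∀ b : Bond d (fineP L m), ‖(U b : 𝔸) - 1‖ ≤ εU)

include hεU hUε in
/-- **`‖(Q(U)A)(c) − (Q(1)A)(c)‖ ≤ 102(d+1)²·L·ε_U·a` FOR A LOCAL BOUND `a`** — `‖A b‖ ≤ a` is required ONLY on the fine bonds starting in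
`B(c₋) ∪ B(c₊)` (print's «with the norm |A′| restricted to the blocks defined above»): `B9Eq315QLipschitz.norm_QtorusLin_sub_flat_le` at the truncation
of `A` to those bonds, which changes neither `(Q(U)A)(c)` nor `(Q(1)A)(c)` (§1).
[cite: Balaban1985BackgroundPropagators, (3.79) p.406, (3.83) p.407; Balaban1985Averaging, (124)–(126) p.36] -/
theorem norm_QtorusLin_sub_flat_le_local (A : Bond d (fineP L m) → 𝔸) (c : Bond d m) {a : ℝ} (ha : 0 ≤ a)
    (hA : ∀ b : Bond d (fineP L m), (blockCoord L m b.1 = c.1 ∨ blockCoord L m b.1 = shift c.2 c.1) → ‖A b‖ ≤ a) :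
    ‖QtorusLin L m hL U hα1 hU1 hreg A c - QtorusLin L m hL (fun _ => 1) hα1' hU1' hreg' A c‖ ≤ 102 * (d + 1) ^ 2 * L * εU * a := by
  classical
  set A' : Bond d (fineP L m) → 𝔸 := fun b => if blockCoord L m b.1 = c.1 ∨ blockCoord L m b.1 = shift c.2 c.1 then A b else 0 with hA'def
  have hAA' : ∀ b : Bond d (fineP L m), (blockCoord L m b.1 = c.1 ∨ blockCoord L m b.1 = shift c.2 c.1) → A b = A' b :=
    fun b hb => by rw [hA'def]; dsimp only; rw [if_pos hb]
  have hA' : ∀ b, ‖A' b‖ ≤ a := fun b => by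
    rw [hA'def]; dsimp only
    split_ifs with hb
    · exact hA b hb
    · rw [norm_zero]; exact ha
  rw [QtorusLin_congr_local L m hL U hα1 hU1 hreg c hAA', QtorusLin_congr_local L m hL (fun _ => 1) hα1' hU1' hreg' c hAA']
  exact norm_QtorusLin_sub_flat_le L m hL U hα1 hU1 hreg hα1' hU1' hreg' hεU hUε A' hA' c

end LocalSup

/-! ## §3 Multiplicity `2d` and the volume-free `δ_Q` on the chain's weighted `L²` carriers -/

section Carriers

/-- **A fine bond starts in the blocks of at most `2d` coarse bonds**: `blockCoord b₋ ∈ {c.1, c.1 + e_{c.2}}` forces `c.1 = blockCoord b₋` or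
`c.1 = blockCoord b₋ − e_{c.2}`, two sites for each of the `d` directions. [cite: Balaban1985Averaging, (2) p.17, p.24] -/
theorem card_near_le (w : TSite d m) :
    (Finset.univ.filter fun c : Bond d m => w = c.1 ∨ w = shift c.2 c.1).card ≤ 2 * d := by
  classical
  have hsub : (Finset.univ.filter fun c : Bond d m => w = c.1 ∨ w = shift c.2 c.1)
      ⊆ (Finset.univ : Finset (Fin d)).biUnion fun κ => {(w, κ), (unshift κ w, κ)} := by
    intro c hc
    simp only [Finset.mem_filter, Finset.mem_univ, true_and] at hc
    simp only [Finset.mem_biUnion, Finset.mem_univ, true_and, Finset.mem_insert, Finset.mem_singleton]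
    refine ⟨c.2, ?_⟩
    rcases hc with h | h
    · exact Or.inl (Prod.ext h.symm rfl)
    · exact Or.inr (Prod.ext (by rw [h, B9SectCLatticeCarrier.unshift_shift]) rfl)
  refine (Finset.card_le_card hsub).trans ((Finset.card_biUnion_le).trans ?_)
  calc ∑ κ : Fin d, ({(w, κ), (unshift κ w, κ)} : Finset (Bond d m)).card ≤ ∑ _κ : Fin d, 2 :=
        Finset.sum_le_sum fun κ _ => Finset.card_insert_le _ _ |>.trans (by rw [Finset.card_singleton])
    _ = 2 * d := by rw [Finset.sum_const, Finset.card_univ, Fintype.card_fin, smul_eq_mul, mul_comm]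

omit [∀ i, NeZero (fineP L m i)] in
/-- **`Σ_c Σ_{b : b₋ ∈ B(c₋) ∪ B(c₊)} F(b) ≤ 2d·Σ_b F(b)`** for `F ≥ 0` (exchange the sums; `card_near_le`). [cite: Balaban1985Averaging, p.24; Balaban1985BackgroundPropagators, (3.83) p.407] -/
theorem sum_sum_near_le (F : Bond d (fineP L m) → ℝ) (hF : ∀ b, 0 ≤ F b) :
    ∑ c : Bond d m, ∑ b ∈ Finset.univ.filter (fun b : Bond d (fineP L m) => blockCoord L m b.1 = c.1 ∨ blockCoord L m b.1 = shift c.2 c.1), F b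
      ≤ 2 * d * ∑ b : Bond d (fineP L m), F b := by
  classical
  calc ∑ c : Bond d m, ∑ b ∈ Finset.univ.filter
          (fun b : Bond d (fineP L m) => blockCoord L m b.1 = c.1 ∨ blockCoord L m b.1 = shift c.2 c.1), F b
      = ∑ c : Bond d m, ∑ b : Bond d (fineP L m),
          (if blockCoord L m b.1 = c.1 ∨ blockCoord L m b.1 = shift c.2 c.1 then F b else 0) :=
        Finset.sum_congr rfl fun c _ => Finset.sum_filter _ _
    _ = ∑ b : Bond d (fineP L m), ∑ c : Bond d m,
          (if blockCoord L m b.1 = c.1 ∨ blockCoord L m b.1 = shift c.2 c.1 then F b else 0) := Finset.sum_comm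
    _ = ∑ b : Bond d (fineP L m),
          ((Finset.univ.filter fun c : Bond d m => blockCoord L m b.1 = c.1 ∨ blockCoord L m b.1 = shift c.2 c.1).card : ℝ) * F b := by
        refine Finset.sum_congr rfl fun b _ => ?_
        rw [← Finset.sum_filter, Finset.sum_const, nsmul_eq_mul]
    _ ≤ ∑ b : Bond d (fineP L m), (2 * d : ℝ) * F b := by
        refine Finset.sum_le_sum fun b _ => mul_le_mul_of_nonneg_right ?_ (hF b)
        exact_mod_cast card_near_le m (blockCoord L m b.1)
    _ = 2 * d * ∑ b : Bond d (fineP L m), F b := by rw [Finset.mul_sum]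

/-- A single term is bounded by the square root of a sum of squares it belongs to. [folklore] [cite: Balaban1985BackgroundPropagators, (3.11) p.392] -/
theorem norm_le_sqrt_sum_near {X : Type*} {V : Type*} [NormedAddCommGroup V] (s : Finset X) (g : X → V) {x : X} (hx : x ∈ s) :
    ‖g x‖ ≤ Real.sqrt (∑ x' ∈ s, ‖g x'‖ ^ 2) := by
  rw [← Real.sqrt_sq (norm_nonneg (g x))]
  exact Real.sqrt_le_sqrt (Finset.single_le_sum (f := fun x' => ‖g x'‖ ^ 2) (fun _ _ => sq_nonneg _) hx)

variable {𝔸 : Type*} [NormedRing 𝔸] [NormedAlgebra ℂ 𝔸] [CompleteSpace 𝔸] [NormOneClass 𝔸] (hL : 1 ≤ L)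
  (U : Bond d (fineP L m) → 𝔸ˣ) {α : ℝ} (hα1 : α ≤ 1 / 64)
  (hU1 : ∀ (x : B7Prop1Explicit.Site d) (κ : Fin d), perCfg (fineP L m) U x κ ∈ U1 𝔸)
  (hreg : ∀ (y : TSite d m) (κ : Fin d) (r : Fin d → Fin L),
    ‖((Wcx L (perCfg (fineP L m) U) (cornerSite L y) κ (boxVec L r) : 𝔸ˣ) : 𝔸) - 1‖ ≤ α)
  {α' : ℝ} (hα1' : α' ≤ 1 / 64)
  (hU1' : ∀ (x : B7Prop1Explicit.Site d) (κ : Fin d), perCfg (fineP L m) (fun _ : Bond d (fineP L m) => (1 : 𝔸ˣ)) x κ ∈ U1 𝔸)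
  (hreg' : ∀ (y : TSite d m) (κ : Fin d) (r : Fin d → Fin L),
    ‖((Wcx L (perCfg (fineP L m) (fun _ : Bond d (fineP L m) => (1 : 𝔸ˣ))) (cornerSite L y) κ (boxVec L r) : 𝔸ˣ) : 𝔸) - 1‖ ≤ α')
  {εU : ℝ} (hεU : 0 ≤ εU) (hUε : ∀ b : Bond d (fineP L m), ‖(U b : 𝔸) - 1‖ ≤ εU)
  {W : Type*} [NormedAddCommGroup W] [InnerProductSpace ℂ W] (φ : W ≃ₗ[ℂ] 𝔸) {c₀ c₁ : ℝ} [Fact (0 < c₀)] [Fact (0 < c₁)]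
  {Mφ Mφ' : ℝ} (hMφ : 0 ≤ Mφ) (hφ : ∀ w, ‖φ w‖ ≤ Mφ * ‖w‖) (hMφ' : 0 ≤ Mφ') (hφ' : ∀ X, ‖φ.symm X‖ ≤ Mφ' * ‖X‖)

include hεU hUε hMφ hφ hMφ' hφ' in
/-- **THE VOLUME-FREE `δ_Q`-LETTER ON THE NE9 CHAIN'S CARRIERS**: `‖Q(U)f − Q(1)f‖ ≤ M_φ′·M_φ·√(2d·c₁∕c₀)·102(d+1)²L·ε_U·‖f‖` for `ε_U ≥ sup_b ‖U(b) − 1‖`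
— the statement of `B9Eq315QLipschitz.norm_QtorusW_sub_flat_le` with `Fintype.card (Bond d m)` replaced by `2d`: per coarse bond the local Lipschitz
letter (§2) with `a_c := M_φ·√(Σ_{b near c} ‖f(b)‖²)`, squared and summed with the coarse weight `c₁`, the double sum re-arranged by `sum_sum_near_le`.
[cite: Balaban1985BackgroundPropagators, (3.15)–(3.16) p.393, (3.79) p.406, (3.83) p.407, Thm 3.11 p.416; Balaban1985Averaging, p.24, (124)–(126) p.36] -/
theorem norm_QtorusW_sub_flat_le_local (f : BondL2K ℂ d (fineP L m) c₀ W) :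
    ‖QtorusW L m hL φ U hα1 hU1 hreg (c₁ := c₁) f - QtorusW L m hL φ (fun _ => 1) hα1' hU1' hreg' (c₁ := c₁) f‖
      ≤ Mφ' * Mφ * Real.sqrt (2 * d * c₁ / c₀) * (102 * (d + 1) ^ 2 * L * εU) * ‖f‖ := by
  classical
  have hc₀ : 0 < c₀ := Fact.out
  have hc₁ : 0 < c₁ := Fact.out
  set K : ℝ := 102 * (d + 1) ^ 2 * L * εU with hK
  have hK0 : 0 ≤ K := by positivity
  set fv : Bond d (fineP L m) → W := WL2.equiv ℂ _ W f with hfv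
  set g : Bond d (fineP L m) → 𝔸 := fun b => φ (fv b) with hg
  -- the local sup of `g` around `c`
  set s : Bond d m → ℝ := fun c => Real.sqrt (∑ b ∈ Finset.univ.filter
    (fun b : Bond d (fineP L m) => blockCoord L m b.1 = c.1 ∨ blockCoord L m b.1 = shift c.2 c.1), ‖fv b‖ ^ 2) with hs
  have hs0 : ∀ c, 0 ≤ s c := fun c => Real.sqrt_nonneg _
  have hga : ∀ (c : Bond d m) (b : Bond d (fineP L m)), (blockCoord L m b.1 = c.1 ∨ blockCoord L m b.1 = shift c.2 c.1) →
      ‖g b‖ ≤ Mφ * s c := fun c b hb =>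
    (hφ _).trans (mul_le_mul_of_nonneg_left (norm_le_sqrt_sum_near _ fv (by simpa using hb)) hMφ)
  -- pointwise on the coarse bonds
  set D := QtorusW L m hL φ U hα1 hU1 hreg (c₁ := c₁) f - QtorusW L m hL φ (fun _ => 1) hα1' hU1' hreg' (c₁ := c₁) f with hD
  have hpt : ∀ c : Bond d m, ‖WL2.equiv ℂ _ W D c‖ ≤ Mφ' * (K * (Mφ * s c)) := by
    intro c
    rw [hD, WL2.equiv_sub, Pi.sub_apply, QtorusW_apply, QtorusW_apply, ← map_sub]
    exact (hφ' _).trans (mul_le_mul_of_nonneg_left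
      (norm_QtorusLin_sub_flat_le_local L m hL U hα1 hU1 hreg hα1' hU1' hreg' hεU hUε g c (mul_nonneg hMφ (hs0 c)) (hga c)) hMφ')
  -- square and sum with the coarse weight
  have hl : ‖f‖ ^ 2 = c₀ * ∑ b : Bond d (fineP L m), ‖fv b‖ ^ 2 := by rw [WL2.norm_sq f, Finset.mul_sum]
  have hf : ∑ b : Bond d (fineP L m), ‖fv b‖ ^ 2 = ‖f‖ ^ 2 / c₀ := by rw [eq_div_iff hc₀.ne', hl, mul_comm]
  have hsq : ‖D‖ ^ 2 ≤ (Mφ' * Mφ * Real.sqrt (2 * d * c₁ / c₀) * K * ‖f‖) ^ 2 := by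
    rw [WL2.norm_sq D]
    calc ∑ c : Bond d m, c₁ * ‖WL2.equiv ℂ _ W D c‖ ^ 2 ≤ ∑ c : Bond d m, c₁ * (Mφ' * (K * (Mφ * s c))) ^ 2 :=
          Finset.sum_le_sum fun c _ => mul_le_mul_of_nonneg_left (pow_le_pow_left₀ (norm_nonneg _) (hpt c) 2) hc₁.le
      _ = c₁ * (Mφ' * K * Mφ) ^ 2 * ∑ c : Bond d m, ∑ b ∈ Finset.univ.filter
            (fun b : Bond d (fineP L m) => blockCoord L m b.1 = c.1 ∨ blockCoord L m b.1 = shift c.2 c.1), ‖fv b‖ ^ 2 := by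
          rw [Finset.mul_sum]
          refine Finset.sum_congr rfl fun c _ => ?_
          have hsc : s c ^ 2 = ∑ b ∈ Finset.univ.filter
              (fun b : Bond d (fineP L m) => blockCoord L m b.1 = c.1 ∨ blockCoord L m b.1 = shift c.2 c.1), ‖fv b‖ ^ 2 :=
            Real.sq_sqrt (Finset.sum_nonneg fun _ _ => sq_nonneg _)
          rw [show c₁ * (Mφ' * (K * (Mφ * s c))) ^ 2 = c₁ * (Mφ' * K * Mφ) ^ 2 * s c ^ 2 by ring, hsc]
      _ ≤ c₁ * (Mφ' * K * Mφ) ^ 2 * (2 * d * ∑ b : Bond d (fineP L m), ‖fv b‖ ^ 2) :=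
          mul_le_mul_of_nonneg_left (sum_sum_near_le L m (fun b => ‖fv b‖ ^ 2) fun _ => sq_nonneg _) (by positivity)
      _ = (Mφ' * Mφ * Real.sqrt (2 * d * c₁ / c₀) * K * ‖f‖) ^ 2 := by
          rw [show (Mφ' * Mφ * Real.sqrt (2 * d * c₁ / c₀) * K * ‖f‖) ^ 2
              = (Mφ' * Mφ * K * ‖f‖) ^ 2 * Real.sqrt (2 * d * c₁ / c₀) ^ 2 by ring, Real.sq_sqrt (by positivity), hf]
          field_simp
  have h0 : 0 ≤ Mφ' * Mφ * Real.sqrt (2 * d * c₁ / c₀) * K * ‖f‖ := by positivity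
  exact (pow_le_pow_iff_left₀ (norm_nonneg _) h0 two_ne_zero).1 hsq

end Carriers

end Literature.MathematicalPhysics.QuantumFieldTheory.Balaban1983to89.B9Eq383QSemiLocal
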